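import Summits.MatrixMultiplication.MatrixMultiplication.Theorems.SoloInformedValPureHubReduction
import Mathlib.Analysis.MeanInequalities

/-!
# The normalised two-block bound `T³ ≤ |G|²·|I|·|J|·|K|` for accidental-free block pairs

Solo-informed MatrixMultiplication, gen 82 (dossier `paper/val-superlinear.md` §15.8 (n)(xvii); CLAIMS c599, c600);
a sequel to `SoloInformedValMixedImages` and `SoloInformedValPureHubReduction`.

SETTING.  Two complete blocks `X₁ × Y₁ × Z₁`, `X₂ × Y₂ × Z₂` (identity potentials in a finite abelian group `G`,
pair graphs `blockPairs`) with `Y₁ ∩ Y₂ = ∅ = Z₁ ∩ Z₂`; the row classes `X₁, X₂` are arbitrary and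
`o = |X₁ ∩ X₂|` (`o ≥ 1` is a hub pair).  Write `v_s = |X_s||Y_s||Z_s|` and `n = |G|`; the union supports exactly
`T = v₁ + v₂` triangles (`card_triangleSet_blockPairs_of_disjoint`) on the vertex classes `I = X₁ ∪ X₂`,
`J = Y₁ ∪ Y₂`, `K = Z₁ ∪ Z₂`.

THE OVERLAP INEQUALITY (`NoAccidental.volume_add_overlap_le`).  If the union is accidental-free then

  `v₁ + o·|Y₂||Z₂| ≤ n`,   and symmetrically   `v₂ + o·|Y₁||Z₁| ≤ n`

(only `Y₁ ∩ Y₂ = ∅` is used).  Proof: the mixed images `M_111 = X₁ + Y₁ - Z₁` and `M_122 = X₁ + Y₂ - Z₂` are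
disjoint (`NoAccidental.disjoint_mixedImage_111_122`), `|M_111| = v₁` (block 1 is a TPP block), and
`M_122 ⊇ (X₁ ∩ X₂) + Y₂ - Z₂`, a sub-box of the TPP block 2, of cardinality `o|Y₂||Z₂|`
(`NoAccidental.card_inter_mul_le_card_mixedImage`).  The coefficient `o` is the point: the face inequalities of
`SoloInformedValHubPairFaces` / `SoloInformedValMixedImages` carry `|Y₂||Z₂|` with coefficient `1` and do not
imply the bound below.

THE THEOREM (`NoAccidental.card_triangleSet_pow_three_le`).  For every accidental-free union of two complete
blocks with disjoint `J`-classes and disjoint `K`-classes,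

  `T³ ≤ n² · |I| · |J| · |K|`,

i.e. the normalised two-block criterion holds for all hub pairs (for `o = 0` it is the trivial two-block bound).
The deduction from the two overlap inequalities is elementary real algebra, isolated in

* `sq_volume_le`: `x₁v₁² + x₂v₂² ≤ n²(x₁ + x₂ - o)` whenever `0 ≤ o ≤ x₁, x₂`, `w_s ≥ 0`, `v_s = x_s w_s`,
  `x₁w₁ + o w₂ ≤ n` and `x₂w₂ + o w₁ ≤ n` (split at `v₁ + v₂ = n`; above the threshold, with `p = n - v₁`,
  `q = n - v₂`, the hypotheses give `o v₁ ≤ x₁ q`, `o v₂ ≤ x₂ p`, and the claim reduces to the quartic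
  inequality `n²pq ≤ (n-p)(2n-p)p² + (n-q)(2n-q)q²` on the triangle `p, q ≥ 0`, `p + q ≤ n`
  (`quartic_le`), which has two explicit polynomial certificates);
* `cube_add_le_mul_mul`: the two-term Hölder inequality `(v₁ + v₂)³ ≤ (a₁ + a₂)(b₁ + b₂)(c₁ + c₂)` for
  `a_s b_s c_s = v_s³`, applied with `a_s = x_s v_s²`, `b_s = |Y_s|`, `c_s = |Z_s|`;

and combined in the numeric criterion `cube_le_of_overlap`.  No `sorry`.
-/

namespace Summit.MatrixMultiplication.MatrixMultiplication.Theorems.SoloVal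

open Finset

/-! ### Real-variable lemmas -/

section RealLemmas

/-- AM–GM for three non-negative reals in product form: `PQR = M³` implies `3M ≤ P + Q + R`. -/
theorem three_mul_le_add_of_mul_eq_pow_three {P Q R M : ℝ} (hP : 0 ≤ P) (hQ : 0 ≤ Q) (hR : 0 ≤ R)
    (hM : 0 ≤ M) (h : P * Q * R = M ^ 3) : 3 * M ≤ P + Q + R := by
  have hw : (0 : ℝ) ≤ ((3 : ℕ) : ℝ)⁻¹ := by positivity
  have hw1 : ((3 : ℕ) : ℝ)⁻¹ + ((3 : ℕ) : ℝ)⁻¹ + ((3 : ℕ) : ℝ)⁻¹ = 1 := by norm_num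
  have key := Real.geom_mean_le_arith_mean3_weighted hw hw hw hP hQ hR hw1
  rw [← Real.mul_rpow hP hQ, ← Real.mul_rpow (mul_nonneg hP hQ) hR, h,
    Real.pow_rpow_inv_natCast (n := 3) hM (by norm_num)] at key
  have h3 : ((3 : ℕ) : ℝ)⁻¹ = 1 / 3 := by norm_num
  rw [h3] at key
  linarith

/-- Two-term Hölder inequality with three factors: if `a_s b_s c_s = v_s³` (`s = 1, 2`; everything
non-negative) then `(v₁ + v₂)³ ≤ (a₁ + a₂)(b₁ + b₂)(c₁ + c₂)`. -/
theorem cube_add_le_mul_mul {a₁ a₂ b₁ b₂ c₁ c₂ v₁ v₂ : ℝ} (ha₁ : 0 ≤ a₁) (ha₂ : 0 ≤ a₂) (hb₁ : 0 ≤ b₁)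
    (hb₂ : 0 ≤ b₂) (hc₁ : 0 ≤ c₁) (hc₂ : 0 ≤ c₂) (hv₁ : 0 ≤ v₁) (hv₂ : 0 ≤ v₂)
    (h₁ : a₁ * b₁ * c₁ = v₁ ^ 3) (h₂ : a₂ * b₂ * c₂ = v₂ ^ 3) :
    (v₁ + v₂) ^ 3 ≤ (a₁ + a₂) * (b₁ + b₂) * (c₁ + c₂) := by
  have e₁ : 3 * (v₁ ^ 2 * v₂) ≤ a₁ * b₁ * c₂ + a₁ * b₂ * c₁ + a₂ * b₁ * c₁ :=
    three_mul_le_add_of_mul_eq_pow_three (by positivity) (by positivity) (by positivity) (by positivity)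
      (by calc a₁ * b₁ * c₂ * (a₁ * b₂ * c₁) * (a₂ * b₁ * c₁)
            = (a₁ * b₁ * c₁) ^ 2 * (a₂ * b₂ * c₂) := by ring
          _ = (v₁ ^ 2 * v₂) ^ 3 := by rw [h₁, h₂]; ring)
  have e₂ : 3 * (v₂ ^ 2 * v₁) ≤ a₂ * b₂ * c₁ + a₂ * b₁ * c₂ + a₁ * b₂ * c₂ :=
    three_mul_le_add_of_mul_eq_pow_three (by positivity) (by positivity) (by positivity) (by positivity)
      (by calc a₂ * b₂ * c₁ * (a₂ * b₁ * c₂) * (a₁ * b₂ * c₂)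
            = (a₂ * b₂ * c₂) ^ 2 * (a₁ * b₁ * c₁) := by ring
          _ = (v₂ ^ 2 * v₁) ^ 3 := by rw [h₁, h₂]; ring)
  calc (v₁ + v₂) ^ 3 = v₁ ^ 3 + v₂ ^ 3 + 3 * (v₁ ^ 2 * v₂) + 3 * (v₂ ^ 2 * v₁) := by ring
    _ ≤ a₁ * b₁ * c₁ + a₂ * b₂ * c₂ + (a₁ * b₁ * c₂ + a₁ * b₂ * c₁ + a₂ * b₁ * c₁)
        + (a₂ * b₂ * c₁ + a₂ * b₁ * c₂ + a₁ * b₂ * c₂) := by linarith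
    _ = (a₁ + a₂) * (b₁ + b₂) * (c₁ + c₂) := by ring

/-- The quartic inequality `n²pq ≤ (n-p)(2n-p)p² + (n-q)(2n-q)q²` on the triangle `0 ≤ p`, `0 ≤ q`,
`p + q ≤ n`, ordered case `p ≤ q`.  Two polynomial certificates: for `2q ≤ n`,
`4E = 4(q-p)(3n-p-q)p² + (n-2q)(5n-2q)(p²+q²) + 3n²(p-q)² + 2n²pq`; for `2q ≥ n`, with `r = n-p-q`,
`E = r(2n-p+q)p² + q·(n r(2q-n) + r²(n+q) + 2pq(n-q))`. -/
theorem quartic_le_of_le {n p q : ℝ} (hp : 0 ≤ p) (hpq : p ≤ q) (hs : p + q ≤ n) :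
    n ^ 2 * p * q ≤ (n - p) * (2 * n - p) * p ^ 2 + (n - q) * (2 * n - q) * q ^ 2 := by
  have hq : 0 ≤ q := hp.trans hpq
  rcases le_total (2 * q) n with h | h
  · have e1 : 0 ≤ (q - p) * (3 * n - p - q) * p ^ 2 :=
      mul_nonneg (mul_nonneg (sub_nonneg.2 hpq) (by linarith)) (sq_nonneg p)
    have e2 : 0 ≤ (n - 2 * q) * (5 * n - 2 * q) * (p ^ 2 + q ^ 2) :=
      mul_nonneg (mul_nonneg (by linarith) (by linarith)) (add_nonneg (sq_nonneg p) (sq_nonneg q))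
    have e3 : 0 ≤ (n * (p - q)) ^ 2 := sq_nonneg _
    have e4 : 0 ≤ n ^ 2 * p * q := mul_nonneg (mul_nonneg (sq_nonneg n) hp) hq
    nlinarith [e1, e2, e3, e4]
  · have hr : 0 ≤ n - p - q := by linarith
    have e1 : 0 ≤ (n - p - q) * (2 * n - p + q) * p ^ 2 :=
      mul_nonneg (mul_nonneg hr (by linarith)) (sq_nonneg p)
    have e2 : 0 ≤ q * (n * ((n - p - q) * (2 * q - n))) :=
      mul_nonneg hq (mul_nonneg (by linarith) (mul_nonneg hr (by linarith)))
    have e3 : 0 ≤ q * ((n - p - q) ^ 2 * (n + q)) :=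
      mul_nonneg hq (mul_nonneg (sq_nonneg _) (by linarith))
    have e4 : 0 ≤ q * (2 * (p * q) * (n - q)) :=
      mul_nonneg hq (mul_nonneg (mul_nonneg (by norm_num) (mul_nonneg hp hq)) (by linarith))
    nlinarith [e1, e2, e3, e4]

/-- The quartic inequality `n²pq ≤ (n-p)(2n-p)p² + (n-q)(2n-q)q²` on the triangle `0 ≤ p`, `0 ≤ q`,
`p + q ≤ n`. -/
theorem quartic_le {n p q : ℝ} (hp : 0 ≤ p) (hq : 0 ≤ q) (hs : p + q ≤ n) :
    n ^ 2 * p * q ≤ (n - p) * (2 * n - p) * p ^ 2 + (n - q) * (2 * n - q) * q ^ 2 := by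
  rcases le_total p q with h | h
  · exact quartic_le_of_le hp h hs
  · have := quartic_le_of_le hq h (by linarith)
    linarith

/-- Above the threshold `v₁ + v₂ ≥ n`: with `p = n - v₁`, `q = n - v₂` on the triangle,
`o(n-p) ≤ x₁q`, `o(n-q) ≤ x₂p` and `0 ≤ o ≤ x₁, x₂` imply `x₁(n-p)² + x₂(n-q)² ≤ n²(x₁ + x₂ - o)`. -/
theorem sq_volume_le_of_codim {n o x₁ x₂ p q : ℝ} (ho : 0 ≤ o) (hox₁ : o ≤ x₁) (hox₂ : o ≤ x₂)
    (hp : 0 ≤ p) (hq : 0 ≤ q) (hs : p + q ≤ n) (h₁ : o * (n - p) ≤ x₁ * q)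
    (h₂ : o * (n - q) ≤ x₂ * p) :
    x₁ * (n - p) ^ 2 + x₂ * (n - q) ^ 2 ≤ n ^ 2 * (x₁ + x₂ - o) := by
  have hx₁ : 0 ≤ x₁ := ho.trans hox₁
  have hx₂ : 0 ≤ x₂ := ho.trans hox₂
  have hn : 0 ≤ n := by linarith
  rcases hp.eq_or_lt with hp0 | hp0
  · -- `p = 0`: then `o(n - q) ≤ 0`, and `o n² ≤ x₂ n q ≤ x₂ q (2n - q)`
    subst hp0
    have e1 : n * (o * (n - q)) ≤ n * (x₂ * 0) := mul_le_mul_of_nonneg_left h₂ hn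
    have e2 : o * (n * q) ≤ x₂ * (n * q) := mul_le_mul_of_nonneg_right hox₂ (mul_nonneg hn hq)
    have e3 : 0 ≤ x₂ * q * (n - q) := mul_nonneg (mul_nonneg hx₂ hq) (by linarith)
    nlinarith [e1, e2, e3]
  rcases hq.eq_or_lt with hq0 | hq0
  · -- `q = 0`, symmetric
    subst hq0
    have e1 : n * (o * (n - p)) ≤ n * (x₁ * 0) := mul_le_mul_of_nonneg_left h₁ hn
    have e2 : o * (n * p) ≤ x₁ * (n * p) := mul_le_mul_of_nonneg_right hox₁ (mul_nonneg hn hp)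
    have e3 : 0 ≤ x₁ * p * (n - p) := mul_nonneg (mul_nonneg hx₁ hp) (by linarith)
    nlinarith [e1, e2, e3]
  -- interior: multiply the claim by `pq > 0` and use the quartic inequality
  have hE := quartic_le hp hq hs
  have e1 : o * (n - p) * (p ^ 2 * (2 * n - p)) ≤ x₁ * q * (p ^ 2 * (2 * n - p)) :=
    mul_le_mul_of_nonneg_right h₁ (mul_nonneg (sq_nonneg p) (by linarith))
  have e2 : o * (n - q) * (q ^ 2 * (2 * n - q)) ≤ x₂ * p * (q ^ 2 * (2 * n - q)) :=
    mul_le_mul_of_nonneg_right h₂ (mul_nonneg (sq_nonneg q) (by linarith))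
  have e3 : 0 ≤ o * ((n - p) * (2 * n - p) * p ^ 2 + (n - q) * (2 * n - q) * q ^ 2 - n ^ 2 * p * q) :=
    mul_nonneg ho (by linarith)
  have key : p * q * (x₁ * (n - p) ^ 2 + x₂ * (n - q) ^ 2) ≤ p * q * (n ^ 2 * (x₁ + x₂ - o)) := by
    nlinarith [e1, e2, e3]
  exact le_of_mul_le_mul_left key (mul_pos hp0 hq0)

/-- THE SQUARED-VOLUME LEMMA.  `0 ≤ o ≤ x₁, x₂`, `w_s ≥ 0`, `x₁w₁ + o w₂ ≤ n` and `x₂w₂ + o w₁ ≤ n` imply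
`x₁(x₁w₁)² + x₂(x₂w₂)² ≤ n²(x₁ + x₂ - o)` (in the application `w_s = |Y_s||Z_s|`, so that `x_s w_s = v_s`). -/
theorem sq_volume_le {n o x₁ x₂ w₁ w₂ : ℝ} (ho : 0 ≤ o) (hox₁ : o ≤ x₁) (hox₂ : o ≤ x₂) (hw₁ : 0 ≤ w₁)
    (hw₂ : 0 ≤ w₂) (hA : x₁ * w₁ + o * w₂ ≤ n) (hB : x₂ * w₂ + o * w₁ ≤ n) :
    x₁ * (x₁ * w₁) ^ 2 + x₂ * (x₂ * w₂) ^ 2 ≤ n ^ 2 * (x₁ + x₂ - o) := by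
  have hx₁ : 0 ≤ x₁ := ho.trans hox₁
  have hx₂ : 0 ≤ x₂ := ho.trans hox₂
  have hv₁ : 0 ≤ x₁ * w₁ := mul_nonneg hx₁ hw₁
  have hv₂ : 0 ≤ x₂ * w₂ := mul_nonneg hx₂ hw₂
  have hv₁n : x₁ * w₁ ≤ n := by nlinarith [mul_nonneg ho hw₂]
  have hv₂n : x₂ * w₂ ≤ n := by nlinarith [mul_nonneg ho hw₁]
  rcases le_total (x₁ * w₁ + x₂ * w₂) n with h | h
  · -- below the threshold `v₁ + v₂ ≤ n`
    have f1 : 0 ≤ n ^ 2 - (x₁ * w₁) ^ 2 := by nlinarith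
    have f2 : 0 ≤ n ^ 2 - (x₂ * w₂) ^ 2 := by nlinarith
    have f3 : 0 ≤ n ^ 2 - (x₁ * w₁) ^ 2 - (x₂ * w₂) ^ 2 := by nlinarith [mul_nonneg hv₁ hv₂]
    nlinarith [mul_nonneg (sub_nonneg.2 hox₁) f1, mul_nonneg (sub_nonneg.2 hox₂) f2, mul_nonneg ho f3]
  · -- above the threshold: `p = n - v₁`, `q = n - v₂`
    have h₁ : o * (n - (n - x₁ * w₁)) ≤ x₁ * (n - x₂ * w₂) := by
      have := mul_le_mul_of_nonneg_left hB hx₁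
      nlinarith
    have h₂ : o * (n - (n - x₂ * w₂)) ≤ x₂ * (n - x₁ * w₁) := by
      have := mul_le_mul_of_nonneg_left hA hx₂
      nlinarith
    have key := sq_volume_le_of_codim ho hox₁ hox₂ (sub_nonneg.2 hv₁n) (sub_nonneg.2 hv₂n)
      (by linarith : (n - x₁ * w₁) + (n - x₂ * w₂) ≤ n) h₁ h₂
    simpa only [sub_sub_cancel] using key

/-- THE NUMERIC CRITERION.  Natural numbers with `x₁y₁z₁ + o·y₂z₂ ≤ n`, `x₂y₂z₂ + o·y₁z₁ ≤ n`, `o ≤ x₁`,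
`o ≤ x₂` and `i + o = x₁ + x₂` satisfy `(x₁y₁z₁ + x₂y₂z₂)³ ≤ n²·i·(y₁ + y₂)·(z₁ + z₂)`. -/
theorem cube_le_of_overlap {n x₁ y₁ z₁ x₂ y₂ z₂ o i : ℕ} (hA : x₁ * y₁ * z₁ + o * y₂ * z₂ ≤ n)
    (hB : x₂ * y₂ * z₂ + o * y₁ * z₁ ≤ n) (ho₁ : o ≤ x₁) (ho₂ : o ≤ x₂) (hi : i + o = x₁ + x₂) :
    (x₁ * y₁ * z₁ + x₂ * y₂ * z₂) ^ 3 ≤ n ^ 2 * i * (y₁ + y₂) * (z₁ + z₂) := by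
  have hA' : (x₁ : ℝ) * ((y₁ : ℝ) * z₁) + (o : ℝ) * ((y₂ : ℝ) * z₂) ≤ n := by
    have h := (Nat.cast_le (α := ℝ)).mpr hA
    push_cast at h
    nlinarith [h]
  have hB' : (x₂ : ℝ) * ((y₂ : ℝ) * z₂) + (o : ℝ) * ((y₁ : ℝ) * z₁) ≤ n := by
    have h := (Nat.cast_le (α := ℝ)).mpr hB
    push_cast at h
    nlinarith [h]
  have ho₁' : (o : ℝ) ≤ x₁ := by exact_mod_cast ho₁
  have ho₂' : (o : ℝ) ≤ x₂ := by exact_mod_cast ho₂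
  have hi' : (i : ℝ) = x₁ + x₂ - o := by
    have h := congrArg (Nat.cast (R := ℝ)) hi
    push_cast at h
    linarith
  have L := sq_volume_le (Nat.cast_nonneg o) ho₁' ho₂' (by positivity) (by positivity) hA' hB'
  have H := cube_add_le_mul_mul (v₁ := (x₁ : ℝ) * ((y₁ : ℝ) * z₁)) (v₂ := (x₂ : ℝ) * ((y₂ : ℝ) * z₂))
    (a₁ := (x₁ : ℝ) * ((x₁ : ℝ) * ((y₁ : ℝ) * z₁)) ^ 2) (a₂ := (x₂ : ℝ) * ((x₂ : ℝ) * ((y₂ : ℝ) * z₂)) ^ 2)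
    (b₁ := (y₁ : ℝ)) (b₂ := (y₂ : ℝ)) (c₁ := (z₁ : ℝ)) (c₂ := (z₂ : ℝ))
    (by positivity) (by positivity) (by positivity) (by positivity) (by positivity) (by positivity)
    (by positivity) (by positivity) (by ring) (by ring)
  have key : ((x₁ : ℝ) * y₁ * z₁ + x₂ * y₂ * z₂) ^ 3 ≤ (n : ℝ) ^ 2 * i * (y₁ + y₂) * (z₁ + z₂) :=
    calc ((x₁ : ℝ) * y₁ * z₁ + x₂ * y₂ * z₂) ^ 3
        = ((x₁ : ℝ) * ((y₁ : ℝ) * z₁) + (x₂ : ℝ) * ((y₂ : ℝ) * z₂)) ^ 3 := by ring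
      _ ≤ ((x₁ : ℝ) * ((x₁ : ℝ) * ((y₁ : ℝ) * z₁)) ^ 2 + (x₂ : ℝ) * ((x₂ : ℝ) * ((y₂ : ℝ) * z₂)) ^ 2)
            * ((y₁ : ℝ) + y₂) * ((z₁ : ℝ) + z₂) := H
      _ ≤ (n : ℝ) ^ 2 * ((x₁ : ℝ) + x₂ - o) * ((y₁ : ℝ) + y₂) * ((z₁ : ℝ) + z₂) :=
          mul_le_mul_of_nonneg_right (mul_le_mul_of_nonneg_right L (by positivity)) (by positivity)
      _ = (n : ℝ) ^ 2 * i * (y₁ + y₂) * (z₁ + z₂) := by rw [hi']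
  exact_mod_cast key

end RealLemmas

/-! ### The overlap inequality and the normalised two-block bound -/

section TwoBlockNormalised

variable {G : Type*} [AddCommGroup G] [DecidableEq G]
variable {X₁ Y₁ Z₁ X₂ Y₂ Z₂ : Finset G}

/-- Mixed images are monotone in the row class. -/
theorem mixedImage_mono {X X' Y Z : Finset G} (h : X ⊆ X') : mixedImage X Y Z ⊆ mixedImage X' Y Z := by
  intro g hg
  obtain ⟨x, hx, y, hy, z, hz, rfl⟩ := mem_mixedImage.mp hg
  exact mem_mixedImage.mpr ⟨x, h hx, y, hy, z, hz, rfl⟩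

/-- The sub-box `(X₁ ∩ X₂) × Y₂ × Z₂` of the TPP block 2 is uniquely represented inside `X₁ + Y₂ - Z₂`:
`|X₁ ∩ X₂||Y₂||Z₂| ≤ |X₁ + Y₂ - Z₂|`. -/
theorem NoAccidental.card_inter_mul_le_card_mixedImage
    (hN : NoAccidental (id : G → G) id id (blockPairs X₁ Y₁ X₂ Y₂) (blockPairs Y₁ Z₁ Y₂ Z₂)
      (blockPairs Z₁ X₁ Z₂ X₂)) :
    (X₁ ∩ X₂).card * Y₂.card * Z₂.card ≤ (mixedImage X₁ Y₂ Z₂).card := by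
  have hinj : Set.InjOn (fun t : G × G × G => t.1 + t.2.1 - t.2.2) ↑((X₁ ∩ X₂) ×ˢ Y₂ ×ˢ Z₂) := by
    rintro ⟨x, y, z⟩ hm ⟨x', y', z'⟩ hm' heq
    simp only [Finset.coe_product, Set.mem_prod, Finset.mem_coe, Finset.mem_inter] at hm hm'
    have heq' : x + y - z = x' + y' - z' := heq
    have h0 : (x - y') + (y - z) + (z' - x') = 0 :=
      calc (x - y') + (y - z) + (z' - x') = (x + y - z) - (x' + y' - z') := by abel
        _ = 0 := by rw [heq', sub_self]
    obtain ⟨hx, hy, hz⟩ := hN x y' y z z' x' (mem_blockPairs.mpr (Or.inr ⟨hm.1.2, hm'.2.1⟩))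
      (mem_blockPairs.mpr (Or.inr ⟨hm.2.1, hm.2.2⟩)) (mem_blockPairs.mpr (Or.inr ⟨hm'.2.2, hm'.1.2⟩)) h0
    rw [hx, ← hy, hz]
  calc (X₁ ∩ X₂).card * Y₂.card * Z₂.card = (mixedImage (X₁ ∩ X₂) Y₂ Z₂).card := by
        unfold mixedImage
        rw [Finset.card_image_of_injOn hinj, Finset.card_product, Finset.card_product, Nat.mul_assoc]
    _ ≤ (mixedImage X₁ Y₂ Z₂).card := Finset.card_le_card (mixedImage_mono Finset.inter_subset_left)

/-- THE OVERLAP INEQUALITY: `|X₁||Y₁||Z₁| + |X₁ ∩ X₂||Y₂||Z₂| ≤ |G|` for an accidental-free pair of complete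
blocks with `Y₁ ∩ Y₂ = ∅` (nothing is assumed about the other classes). -/
theorem NoAccidental.volume_add_overlap_le [Fintype G] (hY : Disjoint Y₁ Y₂)
    (hN : NoAccidental (id : G → G) id id (blockPairs X₁ Y₁ X₂ Y₂) (blockPairs Y₁ Z₁ Y₂ Z₂)
      (blockPairs Z₁ X₁ Z₂ X₂)) :
    X₁.card * Y₁.card * Z₁.card + (X₁ ∩ X₂).card * Y₂.card * Z₂.card ≤ Fintype.card G :=
  calc X₁.card * Y₁.card * Z₁.card + (X₁ ∩ X₂).card * Y₂.card * Z₂.card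
      ≤ (mixedImage X₁ Y₁ Z₁).card + (mixedImage X₁ Y₂ Z₂).card := by
        rw [hN.card_mixedImage_block]
        exact Nat.add_le_add_left hN.card_inter_mul_le_card_mixedImage _
    _ = (mixedImage X₁ Y₁ Z₁ ∪ mixedImage X₁ Y₂ Z₂).card :=
        (Finset.card_union_of_disjoint (hN.disjoint_mixedImage_111_122 hY)).symm
    _ ≤ Fintype.card G := Finset.card_le_univ _

/-- The overlap inequality for the other block: `|X₂||Y₂||Z₂| + |X₁ ∩ X₂||Y₁||Z₁| ≤ |G|`. -/
theorem NoAccidental.volume_add_overlap_le' [Fintype G] (hY : Disjoint Y₁ Y₂)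
    (hN : NoAccidental (id : G → G) id id (blockPairs X₁ Y₁ X₂ Y₂) (blockPairs Y₁ Z₁ Y₂ Z₂)
      (blockPairs Z₁ X₁ Z₂ X₂)) :
    X₂.card * Y₂.card * Z₂.card + (X₁ ∩ X₂).card * Y₁.card * Z₁.card ≤ Fintype.card G := by
  rw [Finset.inter_comm]
  exact hN.swap_blocks.volume_add_overlap_le hY.symm

/-- THE NORMALISED VOLUME BOUND (only `Y₁ ∩ Y₂ = ∅` assumed):
`(|X₁||Y₁||Z₁| + |X₂||Y₂||Z₂|)³ ≤ |G|² · |X₁ ∪ X₂| · (|Y₁| + |Y₂|) · (|Z₁| + |Z₂|)`. -/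
theorem NoAccidental.volume_add_volume_pow_three_le [Fintype G] (hY : Disjoint Y₁ Y₂)
    (hN : NoAccidental (id : G → G) id id (blockPairs X₁ Y₁ X₂ Y₂) (blockPairs Y₁ Z₁ Y₂ Z₂)
      (blockPairs Z₁ X₁ Z₂ X₂)) :
    (X₁.card * Y₁.card * Z₁.card + X₂.card * Y₂.card * Z₂.card) ^ 3
      ≤ Fintype.card G ^ 2 * (X₁ ∪ X₂).card * (Y₁.card + Y₂.card) * (Z₁.card + Z₂.card) :=
  cube_le_of_overlap (hN.volume_add_overlap_le hY) (hN.volume_add_overlap_le' hY)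
    (Finset.card_le_card Finset.inter_subset_left) (Finset.card_le_card Finset.inter_subset_right)
    (Finset.card_union_add_card_inter X₁ X₂)

/-- THE NORMALISED TWO-BLOCK BOUND.  For an accidental-free union of two complete blocks with disjoint
`J`-classes and disjoint `K`-classes (rows arbitrary: disjoint, a hub pair, or several common rows), the number
`T` of supported triangles satisfies `T³ ≤ |G|² · |X₁ ∪ X₂| · |Y₁ ∪ Y₂| · |Z₁ ∪ Z₂|`. -/
theorem NoAccidental.card_triangleSet_pow_three_le [Fintype G] (hY : Disjoint Y₁ Y₂)
    (hZ : Disjoint Z₁ Z₂)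
    (hN : NoAccidental (id : G → G) id id (blockPairs X₁ Y₁ X₂ Y₂) (blockPairs Y₁ Z₁ Y₂ Z₂)
      (blockPairs Z₁ X₁ Z₂ X₂)) :
    (triangleSet (blockPairs X₁ Y₁ X₂ Y₂) (blockPairs Y₁ Z₁ Y₂ Z₂) (blockPairs Z₁ X₁ Z₂ X₂)).card ^ 3
      ≤ Fintype.card G ^ 2 * (X₁ ∪ X₂).card * (Y₁ ∪ Y₂).card * (Z₁ ∪ Z₂).card := by
  rw [card_triangleSet_blockPairs_of_disjoint hY hZ, Finset.card_union_of_disjoint hY,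
    Finset.card_union_of_disjoint hZ]
  exact hN.volume_add_volume_pow_three_le hY

end TwoBlockNormalised

end Summit.MatrixMultiplication.MatrixMultiplication.Theorems.SoloVal
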